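import Summits.QuantumAdvantage.QuantumAdvantage.Theorems.ParityDialE
import HarnessLib

/-!
# CertDial (A) — decomp-qadv lens-2 (structural dichotomy: special vs generic), generation 28, part 1/3

TARGET (by name): the two GENERIC leaves of NODE «ParityDial» (g27, tree `Theorems.ParityDial.closes₃`):
`PGlobalFail 2 2 7` (even lengths: eventually every `𝔽₃`-degree-`≤ 2` strategy that is NOT parity-local of radius 2 loses on an odd-class
input of weight `≤ 7`) and `OGlobalFail 2 2 7` (odd lengths, NOT offset-comb-local of radius 2), which give `Theses.ExactnessDial.NoPerfectTwo3`
(stmt-QuantumAdvantage-27432).  Both UNDECIDED after g27; every SPECIAL class met so far (window rules, parity-local rules, offset-comb rules, any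
radius, any advice) was closed by ONE universal input per length (`xUO`, `xA`/`xB`, the comb killers).

THE DIAL OF THIS GENERATION — REFUTATION CERTIFICATES, by class.  A proof that a class 𝒞 of strategies fails at length `n` is a certificate of
infeasibility of the system «`P ∈ 𝒞` wins every light odd-class input».  Level 0: ONE input on which all of 𝒞 loses (g26–g27).  Level 1: a XOR
certificate — weights `μ_x ∈ 𝔽₂` on inputs with `Σ μ_x · loss_x(P) = 1` for every `P ∈ 𝒞` (level 0 = a point mass; every double-counting /
Tseitin-parity argument is of this form).  Level 2: a SPARSE certificate — a sub-family of inputs whose supports avoid a common arc, unwinnable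
simultaneously.  Level 3: anything global (e.g. an `𝔽₄`-Nullstellensatz certificate: `[R ≡ 1] = 1 + Tr ω^{R-1}` makes the light constraints a
bounded-degree polynomial system in the coefficients).  STRUCTURAL DICHOTOMY, as theorems: the special classes are exactly where level 0/1
certificates exist (their rule tables enter the loss 𝔽₂-LINEARLY, so XOR certificates are complete by linear duality); for the generic
degree-`≥ 1` classes levels 0–2 are PROVABLY EMPTY:

★ THEOREM A (`winParity_attains`, `xorCertificate_trivial`, `no_xor_certificate`; §2): for `n ≥ 3`, `D ≥ 1` and every nonzero `μ` supported on
the odd class, BOTH values of `Σ_x μ_x win_x(P)` are attained by degree-`≤ D` strategies (the zero strategy and a ONE-ROW affine strategy).  Hence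
no XOR certificate exists for the affine class, let alone the quadratic one — at any length, any weight.  ENGINE = the SPAN LEMMA (§1,
`levSpan_eq_top`): the `𝔽₂`-span of the level sets `{x : R x = 1}`, `R` ranging over `𝔽₃`-AFFINE functions, is ALL of `𝔽₂^{cube}` — by the
two-moduli identity `[x_s]·[R=1] = [x_s=1] + [2R+x_s = 1] + [2R = 1]` (`crd_mul_lev`, a 6-case check in `𝔽₃ × Bool`) the span is an ideal
containing `1`, hence contains every point indicator.  So the functional `f ↦ Σ_x μ_x [v_x(t₀)] f(x)` (`v_x` = THE kernel vector of the odd-class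
input `x`, `RingPeriodFold.kernel_pair_of_oddZeros`) cannot vanish on all affine level sets unless `μ = 0`.

★ THEOREM B (`sparseRepair`, `sparse_family_not_universal`; §3): inputs `𝒳` in the odd class vanishing on the arc `[0, L)`, `2|𝒳| + 1 ≤ L ≤ n`,
and ANY rows `Q_t` (any degree) outside the arc: there are AFFINE rows on the arc making every `x ∈ 𝒳` a win.  ENGINE: along a zero arc the kernel
vector ALTERNATES (`kvec_arc`: `v_b = s₀.2 / s₀.1` for `b` even / odd, `s₀ = fixVec ≠ (0,0)` — the two-state automaton of `RingKernel` read through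
`tstep false s = swap s`), so the arc contributes `q_E·Σ_{even arc} z + q_O·Σ_{odd arc} z` with `(q_E, q_O) ≠ (0,0)` constant per input; the
DEFICIT `r(x) = signBit + Σ_{t ≥ L, v_t = 1} [Q_t x = 1]` restricted to `𝒳` is a sum of `≤ |𝒳|` affine level sets (`repOn_short`: the span lemma
+ a minimal-length / linear-dependence argument in `𝒳 → 𝔽₂`), placed on the even resp. odd slots of the arc.
★★ COROLLARY B′ (`no_bounded_universal_family`; §3d, via the tree's rotations `RingRotation.rel_rot` and a pigeonhole free arc): for all `M, w`
and `n ≥ (M·w+1)(2M+1)`, ANY `M` odd-class inputs of weight `≤ w` are won simultaneously by ONE degree-`≤ D` strategy (`D ≥ 1`).  Contrast: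
`ParityDial.xA_parityUniversalHard` — one input of weight 7 defeats every parity-local rule with every advice.

CONSEQUENCES FOR THE TREE (§4–§5; tags in NODE-g28.md): (i) node equation at every weight `w ≥ 7`: `LightFail D w ⟺ GenericLightFail D w :=
PGlobalFail 2 D w ∧ OGlobalFail 2 D w` (`lightFail_iff_generic'`; g27 = the case `w = 7`), `closes : GenericLightFail 2 7 → NoPerfectTwo3` BY NAME;
(ii) the strictly weaker ∃-weight residual `GenericLightFailSome 2` still closes (`closes_some`); (iii) the NECESSARY AFFINE RUNG `AffineLightFail w
:= GenericLightFail 1 w` (`affineLightFail_of_generic`; no numerics exist for it — every census light instance is rotation-covariant) is already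
immune to levels 0–2 by A/B; (iv) hence any proof of either generic leaf must be NONLINEAR in the loss bits AND use input families whose union of
supports is unbounded in `n` — the structured/generic boundary of this lens coincides with the boundary complete-for-XOR / immune-to-XOR.
HONEST LIMITS: nothing here proves or refutes `PGlobalFail 2 2 7`, `OGlobalFail 2 2 7` or 27432; A/B are theorems about PROOF TECHNOLOGY for the
leaves (barrier certificates in the cell's sense), B′ is quantitative (`n ≥ (Mw+1)(2M+1)`), and level 3 is untouched (the 𝔽₄ normal form is a memo
remark, not a declaration).  `lean check` rc 0 · 0 sorry · 0 warning · no `native_decide`/`decide` on data larger than `𝔽₃ × Bool`; axioms standard.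

Main declarations: §1 `lev`, `crd`, `levSpan`, `crd_mul_lev`, `indicator_mem`, `levSpan_eq_top`, `weights_eq_zero_of_orthogonal`; §2 `ans`, `win`,
`dz`, `sgn`, `win_eq`, `oneRow`, `winParity_attains`, `xorCertificate_trivial`; §3 `RepOn`, `repOn_short`, `s₀`, `iter_alt`, `kvec_arc`, `deficit`,
`repair`, `sparseRepair`, `sparse_family_not_universal`, `conjStrat`, `sparse_family_winnable_arc`, `exists_free_arc`, `no_bounded_universal_family`;
§4 `GenericLightFail`, `GenericLightFailSome`, weight/degree monotonicity, `lightFail_iff_generic'`, `genericLightFailSome_iff`, `closes`,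
`closes_some`, `AffineLightFail`, `affineLightFail_of_generic`, `affineLightFail_iff`; §5 `no_xor_certificate`.

THIS PART (1/3): §1 the span lemma (`levSpan_eq_top`, `weights_eq_zero_of_orthogonal`) and §2 THEOREM A (`winParity_attains`,
`xorCertificate_trivial`).  Part B: §3a–§3c THEOREM B (`sparseRepair`, `sparse_family_not_universal`).  Part C: §3d COROLLARY B′
(`no_bounded_universal_family`), §4 the node (`GenericLightFail`, `closes`, `closes_some`, `AffineLightFail`), §5 `no_xor_certificate`.
-/

set_option linter.dupNamespace false
set_option linter.style.longLine false

noncomputable section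
open scoped Classical

namespace Summit.QuantumAdvantage.QuantumAdvantage.Theorems.CertDial
open Finset
open Literature.Computability.QuantumComplexity Literature.Computability.QuantumComplexity.RingHLF
open Summit.QuantumAdvantage.AdviceFreeQNC0
open Literature.Computability.MetaComplexity Literature.Computability.MetaComplexity.Smolensky
open Summit.QuantumAdvantage.QuantumAdvantage.Theorems.RingPeriodFold
  (kvec kernel_pair_of_oddZeros kvec_ne_zero rel_iff_of_kernel_pair)
open Summit.QuantumAdvantage.QuantumAdvantage.Theorems.LightDial (wt lightLosing LightFail mono_singleton_apply)
open Summit.QuantumAdvantage.QuantumAdvantage.Theorems.ParityDial (PGlobalFail OGlobalFail PLocalFail IsParityLocal)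
open Summit.QuantumAdvantage.QuantumAdvantage.Theses.ExactnessDial (NoPerfectTwo3)

variable {n : ℕ}

/-! ## §1 The span lemma: level sets of `𝔽₃`-affine functions are `𝔽₂`-complete -/

/-- `𝔽₂`-valued functions on the cube (loss patterns, answer bits as functions of the input). -/
abbrev BFn (n : ℕ) : Type := (Fin n → Bool) → ZMod 2

/-- the LEVEL SET `[R x = 1]` of an `𝔽₃`-valued cube function `R`, as an `𝔽₂`-valued function: the answer bit of a row `R`. -/
def lev (R : CubeFn (ZMod 3) n) : BFn n := fun x => if R x = 1 then 1 else 0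

/-- the coordinate function `[x_s = 1]` with values in `𝔽₂`. -/
def crd (s : Fin n) : BFn n := fun x => if x s = true then 1 else 0

/-- the level sets of the AFFINE (`𝔽₃`-degree `≤ 1`) functions. -/
def affLev (n : ℕ) : Set (BFn n) := {f | ∃ R ∈ lowDeg (ZMod 3) n 1, f = lev R}

/-- their `𝔽₂`-span. -/
def levSpan (n : ℕ) : Submodule (ZMod 2) (BFn n) := Submodule.span (ZMod 2) (affLev n)

/-- affine level sets lie in the span. -/
theorem lev_mem_levSpan {R : CubeFn (ZMod 3) n} (hR : R ∈ lowDeg (ZMod 3) n 1) : lev R ∈ levSpan n :=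
  Submodule.subset_span ⟨R, hR, rfl⟩

/-- a coordinate monomial has degree `≤ 1`. -/
theorem mono_singleton_mem (s : Fin n) : mono (ZMod 3) ({s} : Finset (Fin n)) ∈ lowDeg (ZMod 3) n 1 :=
  mono_mem_lowDeg (by simp)

/-- ★ THE TWO-MODULI IDENTITY: multiplying an affine level set by a coordinate stays inside the span of affine level sets,
`[x_s]·[R = 1] = [X_s = 1] + [2R + X_s = 1] + [2R = 1]` over `𝔽₂` (check the three values of `R x`). -/
theorem crd_mul_lev (R : CubeFn (ZMod 3) n) (s : Fin n) :
    (fun x => crd s x * lev R x) =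
      lev (mono (ZMod 3) ({s} : Finset (Fin n))) + lev ((2 : ZMod 3) • R + mono (ZMod 3) ({s} : Finset (Fin n)))
        + lev ((2 : ZMod 3) • R) := by
  have key : ∀ (r : ZMod 3) (b : Bool), ((if b = true then (1 : ZMod 2) else 0) * if r = 1 then 1 else 0) =
      ((if (if b = true then (1 : ZMod 3) else 0) = 1 then 1 else 0) + if (2 * r + if b = true then 1 else 0) = 1 then 1 else 0) +
        if 2 * r = 1 then 1 else 0 := by decide
  funext x
  simp only [crd, lev, Pi.add_apply, Pi.smul_apply, smul_eq_mul, mono_singleton_apply]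
  exact key (R x) (x s)

/-- the span of the affine level sets is closed under multiplication by a coordinate … -/
theorem crd_mul_mem {f : BFn n} (hf : f ∈ levSpan n) (s : Fin n) : (fun x => crd s x * f x) ∈ levSpan n := by
  induction hf using Submodule.span_induction with
  | mem g hg =>
    obtain ⟨R, hR, rfl⟩ := hg
    rw [crd_mul_lev]
    refine Submodule.add_mem _ (Submodule.add_mem _ (lev_mem_levSpan (mono_singleton_mem s)) (lev_mem_levSpan ?_))
      (lev_mem_levSpan (Submodule.smul_mem _ _ hR))
    exact Submodule.add_mem _ (Submodule.smul_mem _ _ hR) (mono_singleton_mem s)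
  | zero =>
    have : (fun x => crd s x * (0 : BFn n) x) = 0 := by funext x; simp
    rw [this]; exact Submodule.zero_mem _
  | add g h _ _ ihg ihh =>
    have : (fun x => crd s x * (g + h) x) = (fun x => crd s x * g x) + fun x => crd s x * h x := by
      funext x; simp [mul_add]
    rw [this]; exact Submodule.add_mem _ ihg ihh
  | smul a g _ ih =>
    have : (fun x => crd s x * (a • g) x) = a • fun x => crd s x * g x := by
      funext x; simp [mul_left_comm]
    rw [this]; exact Submodule.smul_mem _ _ ih

/-- … contains the constants … -/
theorem one_mem_levSpan : (fun _ => (1 : ZMod 2)) ∈ levSpan n := by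
  have : (fun _ => (1 : ZMod 2)) = lev (1 : CubeFn (ZMod 3) n) := by funext x; simp [lev]
  rw [this]; exact lev_mem_levSpan (one_mem_lowDeg 1)

/-- … hence contains every partial point indicator … -/
theorem partialIndicator_mem (y : Fin n → Bool) (T : Finset (Fin n)) :
    (fun x => ∏ s ∈ T, (if x s = y s then (1 : ZMod 2) else 0)) ∈ levSpan n := by
  induction T using Finset.induction_on with
  | empty => simpa using one_mem_levSpan
  | insert a T ha ih =>
    have hsplit : (fun x : Fin n → Bool => ∏ s ∈ insert a T, (if x s = y s then (1 : ZMod 2) else 0)) =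
        fun x : Fin n → Bool => (if x a = y a then (1 : ZMod 2) else 0) * ∏ s ∈ T, (if x s = y s then (1 : ZMod 2) else 0) := by
      funext x; rw [Finset.prod_insert ha]
    rw [hsplit]
    cases hya : y a
    · -- `[x_a = 0] = 1 + [x_a = 1]` over `𝔽₂`
      have : (fun x : Fin n → Bool => (if x a = false then (1 : ZMod 2) else 0) * ∏ s ∈ T, (if x s = y s then (1 : ZMod 2) else 0)) =
          (fun x : Fin n → Bool => ∏ s ∈ T, (if x s = y s then (1 : ZMod 2) else 0)) +
            fun x : Fin n → Bool => crd a x * ∏ s ∈ T, (if x s = y s then (1 : ZMod 2) else 0) := by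
        funext x
        simp only [crd, Pi.add_apply]
        cases x a
        · simp
        · simp only [Bool.true_eq_false, if_false, zero_mul, if_true, one_mul]
          generalize (∏ s ∈ T, (if x s = y s then (1 : ZMod 2) else 0)) = p
          revert p; decide
      rw [this]; exact Submodule.add_mem _ ih (crd_mul_mem ih a)
    · have : (fun x : Fin n → Bool => (if x a = true then (1 : ZMod 2) else 0) * ∏ s ∈ T, (if x s = y s then (1 : ZMod 2) else 0)) =
          fun x : Fin n → Bool => crd a x * ∏ s ∈ T, (if x s = y s then (1 : ZMod 2) else 0) := by
        funext x; simp [crd]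
      rw [this]; exact crd_mul_mem ih a

/-- … every point indicator … -/
theorem indicator_mem (y : Fin n → Bool) : (fun x => if x = y then (1 : ZMod 2) else 0) ∈ levSpan n := by
  have : (fun x => if x = y then (1 : ZMod 2) else 0) =
      fun x => ∏ s ∈ (univ : Finset (Fin n)), (if x s = y s then (1 : ZMod 2) else 0) := by
    funext x
    rw [Finset.prod_boole]
    simp only [Finset.mem_univ, true_implies, funext_iff]
  rw [this]; exact partialIndicator_mem y univ

/-- ★ SPAN LEMMA: the `𝔽₂`-span of the answer bits `x ↦ [R x = 1]` of the `𝔽₃`-AFFINE rows `R` is the space of ALL `𝔽₂`-valued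
functions on the cube.  (The minimal form of the two-moduli phenomenon: mod-3 level sets carry no `𝔽₂`-linear invariant.) -/
theorem levSpan_eq_top (n : ℕ) : levSpan n = ⊤ := by
  refine Submodule.eq_top_iff'.2 fun f => ?_
  have hf : f = ∑ y : Fin n → Bool, f y • fun x => if x = y then (1 : ZMod 2) else 0 := by
    funext x
    simp only [Finset.sum_apply, Pi.smul_apply, smul_eq_mul, mul_ite, mul_one, mul_zero]
    rw [Finset.sum_ite_eq]; simp
  rw [hf]
  exact Submodule.sum_mem _ fun y _ => Submodule.smul_mem _ _ (indicator_mem y)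

/-- functional form: a weight vector orthogonal to every affine answer bit is zero. -/
theorem weights_eq_zero_of_orthogonal (μ : BFn n) (h : ∀ R ∈ lowDeg (ZMod 3) n 1, ∑ x, μ x * lev R x = 0) : μ = 0 := by
  -- the functional `f ↦ Σ μ_x f(x)` vanishes on the generators, hence on the span `= ⊤`, hence on point indicators
  let L : BFn n →ₗ[ZMod 2] ZMod 2 :=
    { toFun := fun f => ∑ x, μ x * f x
      map_add' := fun f g => by simp [mul_add, Finset.sum_add_distrib]
      map_smul' := fun a f => by simp [Finset.mul_sum, mul_left_comm] }
  have hker : levSpan n ≤ LinearMap.ker L := by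
    refine Submodule.span_le.2 ?_
    rintro _ ⟨R, hR, rfl⟩
    exact h R hR
  rw [levSpan_eq_top] at hker
  funext y
  have hy : L (fun x => if x = y then (1 : ZMod 2) else 0) = 0 := hker Submodule.mem_top
  have hL : L (fun x => if x = y then (1 : ZMod 2) else 0) = μ y := by
    show ∑ x, μ x * (if x = y then (1 : ZMod 2) else 0) = μ y
    simp [Finset.sum_ite_eq']
  rw [← hL, hy]; rfl

/-! ## §2 No XOR certificate: the loss patterns of (one-row, affine) strategies affinely span everything -/

/-- the answer string of a strategy (one `𝔽₃`-valued cube function per position; answer bit `[P i x = 1]`). -/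
def ans (P : Fin n → CubeFn (ZMod 3) n) (x : Fin n → Bool) : Fin n → Bool := fun i => decide (P i x = 1)

/-- the WIN BIT of strategy `P` on input `x` (`1` = the answer satisfies the ring relation), in `𝔽₂`. -/
def win (P : Fin n → CubeFn (ZMod 3) n) (x : Fin n → Bool) : ZMod 2 := if Rel x (ans P x) then 1 else 0

/-- `⟨v, z⟩` as an element of `𝔽₂`. -/
def dz (v z : Fin n → Bool) : ZMod 2 := ∑ b, if v b = true ∧ z b = true then (1 : ZMod 2) else 0

/-- the sign target `ℓ_x(kvec x)` as an element of `𝔽₂` (before reduction). -/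
def sgn (x : Fin n → Bool) : ZMod 2 := ((edgesIn (kvec x) + wtAnd x (kvec x) / 2 : ℕ) : ZMod 2)

/-- the ring relation's bit equation, read in `𝔽₂`. -/
theorem dot2_eq_signBit_iff (x v z : Fin n → Bool) :
    dot2 v z = signBit x v ↔ dz v z = ((edgesIn v + wtAnd x v / 2 : ℕ) : ZMod 2) := by
  unfold dot2 signBit dz
  rw [← ZMod.natCast_eq_natCast_iff', Finset.natCast_card_filter]

/-- on the odd class the win bit is the single parity test against the canonical kernel vector. -/
theorem win_eq (hn : 3 ≤ n) {x : Fin n → Bool} (hx : OddZeros x) (P : Fin n → CubeFn (ZMod 3) n) :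
    win P x = 1 + dz (kvec x) (ans P x) + sgn x := by
  unfold win
  have hrel : Rel x (ans P x) ↔ dz (kvec x) (ans P x) = sgn x := by
    rw [rel_iff_of_kernel_pair x (kvec x) _ (kernel_pair_of_oddZeros hn hx), dot2_eq_signBit_iff]; rfl
  simp only [hrel]
  generalize dz (kvec x) (ans P x) = a
  generalize sgn x = b
  revert a b; decide

/-- the zero strategy answers the all-`0` string. -/
theorem dz_ans_zero (v x : Fin n → Bool) : dz v (ans (fun _ => (0 : CubeFn (ZMod 3) n)) x) = 0 := by
  unfold dz ans
  simp

/-- the one-row strategy: row `t₀` plays `R`, every other row plays `0`. -/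
def oneRow (t₀ : Fin n) (R : CubeFn (ZMod 3) n) : Fin n → CubeFn (ZMod 3) n := fun i => if i = t₀ then R else 0

/-- a one-row affine strategy has degree `≤ D` for `D ≥ 1`. -/
theorem oneRow_mem {D : ℕ} (hD : 1 ≤ D) (t₀ : Fin n) {R : CubeFn (ZMod 3) n} (hR : R ∈ lowDeg (ZMod 3) n 1) (i : Fin n) :
    oneRow t₀ R i ∈ lowDeg (ZMod 3) n D := by
  unfold oneRow
  split_ifs
  · exact lowDeg_mono hD hR
  · exact Submodule.zero_mem _

/-- the kernel pairing of a one-row strategy is the single answer bit at the row (if the kernel vector sees it). -/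
theorem dz_ans_oneRow (v x : Fin n → Bool) (t₀ : Fin n) (R : CubeFn (ZMod 3) n) :
    dz v (ans (oneRow t₀ R) x) = (if v t₀ = true then 1 else 0) * lev R x := by
  unfold dz ans oneRow lev
  have : ∀ b : Fin n, (if v b = true ∧ decide ((if b = t₀ then R else 0) x = 1) = true then (1 : ZMod 2) else 0) =
      if b = t₀ then (if v t₀ = true then 1 else 0) * (if R x = 1 then 1 else 0) else 0 := by
    intro b
    by_cases hb : b = t₀
    · subst hb
      by_cases hv : v b = true <;> by_cases hR : R x = 1 <;> simp [hv, hR]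
    · simp [hb]
  rw [Finset.sum_congr rfl fun b _ => this b, Finset.sum_ite_eq']; simp

/-- ★ THEOREM A (LOSS PATTERNS AFFINELY SPAN).  For every nonzero weight `μ` supported on odd-class inputs and every target bit `β`
there is a strategy of degree `≤ D` (`D ≥ 1`; in fact a ONE-ROW AFFINE strategy or the zero strategy) whose `μ`-weighted win parity
is `β`.  Equivalently: the win/loss vectors of the degree-`≤ D` strategies are contained in NO proper affine subspace of `𝔽₂^{inputs}`. -/
theorem winParity_attains (hn : 3 ≤ n) {D : ℕ} (hD : 1 ≤ D) (μ : BFn n) (hμ : ∀ x, μ x ≠ 0 → OddZeros x)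
    (hne : μ ≠ 0) (β : ZMod 2) :
    ∃ P : Fin n → CubeFn (ZMod 3) n, (∀ i, P i ∈ lowDeg (ZMod 3) n D) ∧ ∑ x, μ x * win P x = β := by
  -- a charged input `x₀` and a support position `t₀` of its kernel vector
  obtain ⟨x₀, hx₀⟩ : ∃ x₀, μ x₀ ≠ 0 := by
    by_contra h; push Not at h; exact hne (funext h)
  have hodd₀ := hμ x₀ hx₀
  obtain ⟨t₀, ht₀⟩ : ∃ t₀, kvec x₀ t₀ = true := by
    by_contra h; push Not at h
    exact kvec_ne_zero hn hodd₀ (funext fun i => by simpa using h i)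
  -- the weights `μ_x · [kvec x t₀]` are not all zero, so some affine answer bit has odd weighted parity against them
  let κ : BFn n := fun x => if kvec x t₀ = true then 1 else 0
  have hκμ : (fun x => μ x * κ x) ≠ 0 := by
    intro h
    have := congrFun h x₀
    simp only [κ, ht₀, if_true, mul_one, Pi.zero_apply] at this
    exact hx₀ this
  obtain ⟨R, hR, hR1⟩ : ∃ R ∈ lowDeg (ZMod 3) n 1, ∑ x, (μ x * κ x) * lev R x = 1 := by
    by_contra h; push Not at h
    refine hκμ (weights_eq_zero_of_orthogonal _ fun R hR => ?_)
    have h01 : ∀ a : ZMod 2, a ≠ 1 → a = 0 := by decide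
    exact h01 _ (h R hR)
  -- win parities of the zero strategy (`W₀`) and of the one-row strategy (`W₀ + 1`)
  have hsum : ∀ P : Fin n → CubeFn (ZMod 3) n,
      ∑ x, μ x * win P x = ∑ x, μ x * (1 + dz (kvec x) (ans P x) + sgn x) := by
    intro P
    refine Finset.sum_congr rfl fun x _ => ?_
    by_cases hx : μ x = 0
    · simp [hx]
    · rw [win_eq hn (hμ x hx)]
  have hW1 : ∑ x, μ x * win (oneRow t₀ R) x = ∑ x, μ x * win (fun _ => (0 : CubeFn (ZMod 3) n)) x + 1 := by
    rw [hsum, hsum, ← hR1, ← Finset.sum_add_distrib]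
    refine Finset.sum_congr rfl fun x _ => ?_
    rw [dz_ans_zero, dz_ans_oneRow]
    ring
  by_cases hβ : β = ∑ x, μ x * win (fun _ => (0 : CubeFn (ZMod 3) n)) x
  · exact ⟨fun _ => 0, fun _ => Submodule.zero_mem _, hβ.symm⟩
  · refine ⟨oneRow t₀ R, oneRow_mem hD t₀ hR, ?_⟩
    rw [hW1]
    generalize ∑ x, μ x * win (fun _ => (0 : CubeFn (ZMod 3) n)) x = W at hβ ⊢
    revert β W; decide

/-- ★ COROLLARY (NO XOR CERTIFICATE).  The only `𝔽₂`-affine relation `Σ_x μ_x · win_P(x) = β` satisfied by ALL strategies of degree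
`≤ D` (`D ≥ 1`, `μ` supported on the odd class) is the trivial one `μ = 0`: no `𝔽₂`-linear combination of loss bits — in particular
no single «universal» input and no finite XOR-sum of inputs — certifies that every degree-`≤ D` strategy loses somewhere. -/
theorem xorCertificate_trivial (hn : 3 ≤ n) {D : ℕ} (hD : 1 ≤ D) (μ : BFn n) (hμ : ∀ x, μ x ≠ 0 → OddZeros x) (β : ZMod 2)
    (h : ∀ P : Fin n → CubeFn (ZMod 3) n, (∀ i, P i ∈ lowDeg (ZMod 3) n D) → ∑ x, μ x * win P x = β) : μ = 0 := by
  by_contra hne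
  obtain ⟨P, hP, hPβ⟩ := winParity_attains hn hD μ hμ hne (β + 1)
  have := h P hP
  rw [hPβ] at this
  revert this; generalize β = b; revert b; decide

end Summit.QuantumAdvantage.QuantumAdvantage.Theorems.CertDial
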